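import Mathlib
import Summits.Ventures.PercRepro.TriangleCapDiagonalLocus

/-!
# PercRepro — THE EQUALITY LOCUS OF THE DIAGONAL AT SECOND ORDER ON THE ROW `a = 3`, THE PIECES: the hung `K_{4,4}`
(`HungK44`), its degree profile, the neighbours of a deleted vertex on one side when they are complete to the other
side, and the cross-row case at equality with the `(9, 18)` exception (p3, gen 44; part 197c)

`HungK44 D`: a vertex `z` of degree `2` whose deletion is `K_{4,4}` (a spanning subgraph of `K(A, Aᶜ)`, `|A| = 4`,
`16` edges), its two neighbours on opposite sides — the `5,040` one-triangle maximisers of `(9, 18)` of §10bu(f),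
degrees `5 5 4 4 4 4 4 4 2`; at most two vertices of degree `5` (`hungK44_card_deg_five`). The cross-row deletion
of a vertex of degree `d ≤ 2` at equality (`three_cross_eq`) is on the boundary `k + d = 11` (`diag_cross_boundary`
at `a = 3`), `D − z = K_{4,k−5}` with the neighbours of `z` at degree `k − 5`: on the `4`-side for `k ≥ 10`, and at
`k = 9` (`d = 2`) on one side (`4`-bipartite) or on both (`HungK44`). Axioms: standard.
-/

namespace PercRepro

namespace TriangleCap

namespace C047

open Finset

universe u

variable {V : Type*} [Fintype V] [DecidableEq V]

/-- **`K_{4,4}` WITH A VERTEX HUNG ON AN EDGE:** a vertex `z` of degree `2` whose deletion is a spanning subgraph of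
`K(A, Aᶜ)` with `|A| = 4` and `16` edges (so `K_{4,4}`), the two neighbours of `z` on opposite sides. -/
def HungK44 (D : SimpleGraph V) [DecidableRel D.Adj] : Prop :=
  ∃ (z : V) (A : Finset {v : V // v ≠ z}), deg D z = 2 ∧ A.card = 4 ∧ BipSub (del D z) A ∧
    (del D z).edgeFinset.card = 16 ∧ ∃ x y : {v : V // v ≠ z}, x ∈ A ∧ y ∉ A ∧ D.Adj x.1 z ∧ D.Adj y.1 z

/-- The neighbours of `z` as a finset of `D − z`'s vertices have `d(z)` elements. -/
theorem card_nbhd_del (D : SimpleGraph V) [DecidableRel D.Adj] (z : V) :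
    (univ.filter (fun w : {v : V // v ≠ z} => D.Adj w.1 z)).card = deg D z := by
  have h := sum_del_nbhd_const D z 1
  rw [mul_one, ← card_filter] at h
  exact h

/-- In a spanning subgraph of `K(A, Aᶜ)` every degree is `≤ max (|A|, k − |A|)`: on `A` at most `k − |A|`. -/
theorem deg_le_of_bipSub_mem (H : SimpleGraph V) [DecidableRel H.Adj] (A : Finset V) (hH : BipSub H A) (x : V)
    (hx : x ∈ A) : deg H x ≤ Fintype.card V - A.card := by
  have := deg_le_card_of_bipSub H Aᶜ (bipSub_compl H A hH) x (by rw [mem_compl, not_not]; exact hx)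
  rw [card_compl] at this
  exact this

/-- In the hung `K_{4,4}` at most two vertices have degree `5` (the two ends of the hung edge). -/
theorem hungK44_card_deg_five (D : SimpleGraph V) [DecidableRel D.Adj] (hk : Fintype.card V = 9)
    (hH : HungK44 D) (S : Finset V) (hS : ∀ w ∈ S, deg D w = 5) : S.card ≤ 2 := by
  obtain ⟨z, A, hz2, hA4, hB, -, -⟩ := hH
  have hcard' := card_del z
  have hsub : S ⊆ univ.filter (fun w => D.Adj z w) := by
    intro w hw
    have hw5 := hS w hw
    rw [mem_filter]
    refine ⟨mem_univ _, ?_⟩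
    have hwz : w ≠ z := fun h => by rw [h] at hw5; omega
    have hd := deg_del D z ⟨w, hwz⟩
    have hle : deg (del D z) ⟨w, hwz⟩ ≤ 4 := by
      by_cases hwA : (⟨w, hwz⟩ : {v : V // v ≠ z}) ∈ A
      · have := deg_le_of_bipSub_mem (del D z) A hB _ hwA
        rw [hA4] at this
        omega
      · have := deg_le_card_of_bipSub (del D z) A hB _ hwA
        rw [hA4] at this
        exact this
    simp only at hd
    by_contra hadj
    rw [if_neg (fun h => hadj (D.adj_symm h))] at hd
    omega
  have := card_le_card hsub
  unfold deg at hz2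
  omega

/-- **THE NEIGHBOURS OF `z` LIE ON ONE SIDE WHEN THEY ARE COMPLETE TO THE OTHER SIDE:** `D − z ⊆ K(A, Aᶜ)`, every
neighbour of `z` adjacent to the whole other side, `d(z) ≥ 3` ⇒ all in `A` or all off `A`. -/
theorem nbhd_one_side_of_full (D : SimpleGraph V) [DecidableRel D.Adj] (hK : K4mFree D) (z : V)
    (A : Finset {v : V // v ≠ z}) (hfull : ∀ w : {v : V // v ≠ z}, D.Adj w.1 z →
      ∀ u : {v : V // v ≠ z}, (w ∈ A ↔ u ∉ A) → (del D z).Adj w u)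
    (hd : 3 ≤ deg D z) :
    (∀ w : {v : V // v ≠ z}, D.Adj w.1 z → w ∈ A) ∨ (∀ w : {v : V // v ≠ z}, D.Adj w.1 z → w ∉ A) := by
  by_contra hcon
  push Not at hcon
  obtain ⟨⟨q, hqz, hqA⟩, ⟨p, hpz, hpA⟩⟩ := hcon
  have hpq : p ≠ q := fun h => hqA (h ▸ hpA)
  -- a third neighbour
  obtain ⟨w, hwz, hwp, hwq⟩ : ∃ w : {v : V // v ≠ z}, D.Adj w.1 z ∧ w ≠ p ∧ w ≠ q := by
    have h3 : 2 < (univ.filter (fun w : {v : V // v ≠ z} => D.Adj w.1 z)).card := by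
      rw [card_nbhd_del]; omega
    obtain ⟨b₁, hb₁, b₂, hb₂, b₃, hb₃, h12, h13, h23⟩ := two_lt_card.mp h3
    rw [mem_filter] at hb₁ hb₂ hb₃
    by_cases e1 : b₁ = p ∨ b₁ = q
    · by_cases e2 : b₂ = p ∨ b₂ = q
      · refine ⟨b₃, hb₃.2, ?_, ?_⟩
        · intro h; rcases e1 with rfl | rfl <;> rcases e2 with rfl | rfl <;>
            first | exact h12 rfl | exact h13 h | exact h13 h.symm | exact h23 h | exact h23 h.symm
        · intro h; rcases e1 with rfl | rfl <;> rcases e2 with rfl | rfl <;>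
            first | exact h12 rfl | exact h13 h | exact h13 h.symm | exact h23 h | exact h23 h.symm
      · push Not at e2
        exact ⟨b₂, hb₂.2, e2.1, e2.2⟩
    · push Not at e1
      exact ⟨b₁, hb₁.2, e1.1, e1.2⟩
  have hpq' : D.Adj p.1 q.1 := (del_adj D z p q).mp (hfull p hpz q (by tauto))
  by_cases hwA : w ∈ A
  · -- the triangles `z p q` and `z w q` share `z q`
    have hwq' : D.Adj w.1 q.1 := (del_adj D z w q).mp (hfull w hwz q (by tauto))
    exact not_adj_both D hK (D.adj_symm hqz) (D.adj_symm hpz) (D.adj_symm hpq')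
      (fun h => hwp (Subtype.ext h).symm) (D.adj_symm hwz) (D.adj_symm hwq')
  · -- the triangles `z p q` and `z p w` share `z p`
    have hpw' : D.Adj p.1 w.1 := (del_adj D z p w).mp (hfull p hpz w (by tauto))
    exact not_adj_both D hK (D.adj_symm hpz) (D.adj_symm hqz) hpq'
      (fun h => hwq (Subtype.ext h).symm) (D.adj_symm hwz) hpw'

/-- **THE CROSS-ROW CASE AT EQUALITY ON THE ROW `a = 3`, THE STRUCTURE:** on the boundary `k + d = 11` with `D − z`
at the envelope and the neighbours of `z` at `k − 5`: `D − z = K_{4,k−5}`; for `k ≥ 10` the neighbours lie on the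
`4`-side (`D` is `4`-bipartite), at `k = 9` on one side (`4`-bipartite) or on both (the hung `K_{4,4}`). -/
theorem three_cross_structure (D : SimpleGraph V) [DecidableRel D.Adj] (hK : K4mFree D) (z : V)
    (hkd : Fintype.card V + deg D z = 11) (hz : deg D z + 1 ≤ 3)
    (hmd : (del D z).edgeFinset.card + deg D z = 3 * (Fintype.card V - 3))
    (hS'eq : ∑ w : {v : V // v ≠ z}, deg (del D z) w * deg (del D z) w =
      (del D z).edgeFinset.card * Fintype.card {v : V // v ≠ z})
    (hdeg : ∀ w : {v : V // v ≠ z}, D.Adj w.1 z → deg (del D z) w = Fintype.card V - 3 - 2) :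
    (∃ A : Finset V, A.card = 4 ∧ BipSub D A) ∨ (Fintype.card V = 9 ∧ HungK44 D) := by
  have hK' := k4mFree_del D hK z
  have hcard' := card_del z
  obtain ⟨k, hk'⟩ : ∃ k, Fintype.card V = k := ⟨_, rfl⟩
  have hk'' : Fintype.card {v : V // v ≠ z} = k - 1 := by omega
  obtain ⟨d, hd⟩ : ∃ d, deg D z = d := ⟨_, rfl⟩
  obtain ⟨m', hm'def⟩ : ∃ m', (del D z).edgeFinset.card = m' := ⟨_, rfl⟩
  rw [hk'] at hkd hmd hdeg ⊢
  rw [hd] at hkd hz hmd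
  rw [hm'def] at hmd
  obtain ⟨he1, -⟩ := diag_cross_eq_edges 3 d k m' hkd hz hmd
  -- `D − z` is `K_{4,k−5}`
  obtain ⟨A', -, hA'card, hA', -⟩ := (closed_form_eq_iff (del D z) hK' 4 0 (by omega)
    (by rw [hk'']; omega) (by rw [hk'']; omega) (by rw [hm'def, hk'']; exact he1)).mp (by
      rw [hS'eq]
      simp only [zero_mul, add_zero])
  rcases Nat.lt_or_ge 9 k with hk10 | hk9
  · -- `k ≥ 10`: a vertex off `A'` has degree `≤ 4 < k − 5`
    left
    have hin : ∀ w : {v : V // v ≠ z}, D.Adj w.1 z → w ∈ A' := by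
      intro w hw
      by_contra hwA
      have h1 := deg_le_card_of_bipSub (del D z) A' hA' w hwA
      have h2 := hdeg w hw
      omega
    obtain ⟨B, hBcard, hB⟩ := bipSub_lift D z A' hA' hin
    exact ⟨B, by rw [hBcard, hA'card], hB⟩
  · -- `k = 9`, `d = 2`
    have hk9' : k = 9 := by omega
    have hd2 : d = 2 := by omega
    by_cases hin : ∀ w : {v : V // v ≠ z}, D.Adj w.1 z → w ∈ A'
    · left
      obtain ⟨B, hBcard, hB⟩ := bipSub_lift D z A' hA' hin
      exact ⟨B, by rw [hBcard, hA'card], hB⟩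
    by_cases hoff : ∀ w : {v : V // v ≠ z}, D.Adj w.1 z → w ∉ A'
    · left
      have hA'c : BipSub (del D z) A'ᶜ := bipSub_compl (del D z) A' hA'
      obtain ⟨B, hBcard, hB⟩ := bipSub_lift D z A'ᶜ hA'c (fun w hw => mem_compl.mpr (hoff w hw))
      refine ⟨B, ?_, hB⟩
      rw [hBcard, card_compl, hA'card, hk'', hk9']
    · right
      push Not at hin hoff
      obtain ⟨y, hyz, hyA⟩ := hin
      obtain ⟨x, hxz, hxA⟩ := hoff
      refine ⟨hk9', z, A', by omega, hA'card, hA', ?_, x, y, hxA, hyA, hxz, hyz⟩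
      rw [hm'def]
      omega

/-- **THE CROSS-ROW CASE AT EQUALITY ON THE ROW `a = 3`:** `m + 9 = 3k`, `8 ≤ k`, every degree `≤ k − 4`, a vertex `z`
of degree `≤ 2`, `Σ_v d(v)² + 6 (k − 7) = m k` ⇒ `D` is `4`-bipartite, or `k = 9` and `D` is the hung `K_{4,4}`. -/
theorem three_cross_eq (D : SimpleGraph V) [DecidableRel D.Adj] (hK : K4mFree D)
    (hk : 8 ≤ Fintype.card V) (hm : D.edgeFinset.card + 9 = 3 * Fintype.card V)
    (hcap : ∀ v, deg D v + 4 ≤ Fintype.card V) (z : V) (hz : deg D z ≤ 2)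
    (heq : ∑ v, deg D v * deg D v + 6 * (Fintype.card V - 7) = D.edgeFinset.card * Fintype.card V) :
    (∃ A : Finset V, A.card = 4 ∧ BipSub D A) ∨ (Fintype.card V = 9 ∧ HungK44 D) := by
  have hK' := k4mFree_del D hK z
  have hcard' := card_del z
  have hedges' := card_edges_del D z
  have hsq := sum_deg_sq_del D z
  have hT := sum_del_nbhd_le D z (Fintype.card V - 3 - 2) (fun v => by have := hcap v; omega)
  have hmd : (del D z).edgeFinset.card + deg D z = 3 * (Fintype.card V - 3) := by rw [hedges']; omega
  obtain ⟨T, hTdef⟩ : ∃ T, ∑ w : {v : V // v ≠ z}, (if D.Adj w.1 z then deg (del D z) w else 0) = T := ⟨_, rfl⟩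
  obtain ⟨S', hS'def⟩ : ∃ S', ∑ w : {v : V // v ≠ z}, deg (del D z) w * deg (del D z) w = S' := ⟨_, rfl⟩
  obtain ⟨m', hm'def⟩ : ∃ m', (del D z).edgeFinset.card = m' := ⟨_, rfl⟩
  obtain ⟨d, hd⟩ : ∃ d, deg D z = d := ⟨_, rfl⟩
  obtain ⟨k, hk'⟩ : ∃ k, Fintype.card V = k := ⟨_, rfl⟩
  have hk'' : Fintype.card {v : V // v ≠ z} = k - 1 := by omega
  have henv : k + d < 3 * 3 + 2 → S' ≤ m' * (k - 1) := fun _ => by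
    have h := sum_deg_sq_le_of_k4mFree (del D z) hK' (by omega)
    rw [hS'def, hm'def, hk''] at h
    exact h
  have hcell : 3 * 3 + 2 ≤ k + d →
      S' + (k + d - (3 * 3 + 2)) * (k - 1 - 1 - (k + d - (3 * 3 + 2))) ≤ m' * (k - 1) := fun hl => by
    obtain ⟨hc2, hc3⟩ := below_cross_cell_side 3 0 d k m' (by omega) (by omega)
      (by rw [← hm'def, ← hd, ← hk']; simpa using hmd)
    rw [← hk''] at hc2 hc3
    rw [← hm'def] at hc3
    have h := closed_form_stability (del D z) hK' (3 + 1) (k + 0 + d - (3 * 3 + 2)) (by omega) hc2 hc3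
    rw [hS'def, hm'def, hk''] at h
    simpa using h
  rw [hd] at hz hedges' hsq hT hmd
  rw [hTdef] at hsq hT
  rw [hS'def] at hsq
  rw [hm'def] at hedges' hmd
  rw [hk'] at hk hm hT heq hmd
  rw [hsq, ← hedges'] at heq
  have heq' : S' + 2 * T + d + d * d + 2 * 3 * (k - 2 * 3 - 1) = (m' + d) * k := by
    have e : 2 * 3 * (k - 2 * 3 - 1) = 6 * (k - 7) := by omega
    rw [e]; exact heq
  obtain ⟨hkd, hS'eq, hTeq'⟩ := diag_cross_boundary 3 d k m' S' T (by omega) (by omega) hmd hT henv hcell heq'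
  have hTeq := deg_del_eq_of_sum_eq D z (Fintype.card V - 3 - 2) (fun v => by have := hcap v; omega)
    (by rw [hTdef, hd, hk', hTeq'])
  apply three_cross_structure D hK z (by omega) (by omega) (by rw [← hm'def, ← hd] at hmd; rw [hk']; exact hmd)
  · rw [hS'def, hm'def, hk'']; exact hS'eq
  · intro w hw; exact hTeq w hw

end C047

end TriangleCap

end PercRepro
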